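import Summits.QuantumFields.BalabanUV.T4Continuum.Support.NE3EnergyHessContTwoTerm
import Summits.QuantumFields.BalabanUV.T4Continuum.Support.NE3EnergySmallFieldCurl
import Literature.MathematicalPhysics.QuantumFieldTheory.Balaban1983to89.T4ConvexResponse

/-!
# T⁴ programme, node NE3 — sub-row S5-Y8a-1e: THE LOCAL ACTION READ-OUT TO SECOND ORDER WITH THE TWO-TERM HESSIAN
# BOUND (a (READOUT♯)-TYPE supplier): `|A_W(V e^X) − A_W(V)| ≤ a·Σ_W‖d_V X‖ + Σ_W‖d_V X‖² + (6a + 6γ + 144(e^α−1)(α + e^α−1))·Σ_W bondSq X`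

NE3 (node U1b) formalisation swarm, leaf seat `b2b-balaban-t4-ne3-formalise-leaf-03` (gen 5), sub-row **S5-Y8a-1e** of
`HOME/t4/formal/NE3/LEAVES.md` (journal INTENT ∕ CLAIM l.12726), continuation of this lineage's two-term chain S5-Y8a-1c
(`NE3EnergyHessTwoTerm`, `NE3EnergyHessContTwoTerm`) and S5-Y8a-1d (`NE3EnergySmallFieldCurl`).  CONTEXT: the row
owner's located error and repair census `HOME/t4/b2b-balaban-t4-ne3-p1/g19/F-ne3p1-g19-1.md` §3 (R3) lists, for the
LOCAL consumers of the surviving variant, the estimate **(READOUT♯)**: «`|A_Y(V e^X) − A_Y(V)| ≤ a·Σ_Y‖curl_V X‖ +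
C₁·Σ_Y‖curl_V X‖² + C₂·(a + ‖X‖_∞)·Σ_Y bondSq X` (the true shape of the second variation: at a flat plaquette it is
‖curl‖²-dominated, the bondSq part carries the plaquette radius) replacing `NE3LocalReadouts.abs_fineAction_vary_sub_le`'s
`(7∕2)·Σ bondSq`».  THIS FILE proves a window-local calculus lemma of exactly that TYPE, over tree lemmas BY NAME ([folklore];
0 `def`, 0 `sorry`); the E-READOUT♯ SOCKET of the owner's skeleton v1.9 is NOT claimed here — the owner re-binders at will.

For unitary `V` with plaquette radius `a ≥ 0` on a window `W` (`‖V(∂p) − 1‖ ≤ a`, `p ∈ W`), a skew direction `X` with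
`‖X(b)‖ ≤ α` (`α ≥ 0`) and a window curl bound `‖(d_V X)(p)‖ ≤ γ` (`p ∈ W`, `γ ≥ 0`); abbreviations (docstring only)
`C := Σ_{p∈W}‖(d_V X)(p)‖²`, `B := Σ_{p∈W} bondSq X p`, `δ := e^α − 1`, `R := √C + 12δ√B`, `a′ := a + γ + 24αδ`:
* §1 `abs_hess_vary_self_le_twoTerm` — for `t ∈ [0,1]`: `|hess (V e^{tX}) X X W| ≤ R² + 12·a′·B`
  (`NE3EnergyHessTwoTerm.abs_hess_le_twoTerm` at the moving configuration, whose plaquette radius on `W` is `≤ a′` by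
  `NE3EnergySmallFieldCurl.norm_fhol_vary_sub_one_le_curl`, and whose window curl is transported by
  `NE3EnergyHessContTwoTerm.sqrt_sum_curl_sq_vary_le`: `√C_t ≤ √C + 12(e^{|t|α} − 1)√B ≤ R`);
* §2 **`abs_fineAction_vary_sub_sub_dAction_le_twoTerm`** — `|A_W(V e^X) − A_W(V) − dAction V X W| ≤ ½·(R² + 12a′B)`
  (`T4ConvexResponse.taylor_lower` for the action and its negative over `NE3HessForm.segment_derivData`, exactly as
  `NE3LocalReadouts.abs_fineAction_vary_sub_sub_dAction_le`, with §1 in place of the uniform `7·Σ bondSq`);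
* §3 **`abs_fineAction_vary_sub_le_twoTerm`** — `|A_W(V e^X) − A_W(V)| ≤ a·Σ_W‖(d_V X)(p)‖ + ½·(R² + 12a′B)` (first
  variation by `NE3EnergySource.abs_sum_nReTr_curl_fhol_le`), and the POLYNOMIAL DISPLAY
  **`abs_fineAction_vary_sub_le_readout`** — `|A_W(V e^X) − A_W(V)| ≤ a·Σ_W‖d_V X‖ + Σ_W‖d_V X‖² + (6a + 6γ + 144δ(α + δ))·Σ_W bondSq X`
  (`R² ≤ 2C + 288δ²B`): the (READOUT♯) TYPE with `C₁ = 1` and the radius ∕ sup dependence displayed (`γ` is itself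
  `O(α + a·α)` for unitary `V`, kept as a datum; `δ(α + δ) = O(α²)`).
* §4 THE SOCKET SHAPE of the owner's skeleton v1.9 §4b (E-READOUT♯, «`|A_Y(V e^X) − A_Y(V) − dAction_Y(X)| ≤ C₁·Σ_Y‖curl_V X‖²
  + C₂·(a + ‖X‖_∞ + ‖X‖_∞²)·Σ_Y bondSq X`», crew): **`abs_fineAction_vary_sub_sub_dAction_le_readout`** —
  `|A_W(V e^X) − A_W(V) − dAction V X W| ≤ Σ_W‖d_V X‖² + (6a + 24α + 144δ(α + δ))·Σ_W bondSq X` (`γ ≤ 4α` by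
  `NE3HessBounds.norm_curlAt_le`; `C₁ = 1`, `C₂`-term `6a + 24α + O(α²)`), and `abs_fineAction_vary_sub_le_readout'`.

HONEST FRAMING.  Finite-T⁴ bookkeeping (rung (B)+1); window-local matrix calculus over landed lemmas; NOTHING about
Bałaban's minimisers; no norm chosen, no coercivity, no `k`; T-E ∕ T-E_w NOT proved; NE3 NOT proved; spine PROVED 0∕9; no
conditional of the cell used or hidden; NOT infinite volume, NOT a mass gap, NOT Clay, NOT summit progress.  ABSOLUTE RULE
kept: no printed sentence is a hypothesis (context only: [Balaban1985Variational] (26)–(28) p. 282 — the expansion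
`𝒜 = A(U₀) + ⟨A,J⟩ + ½⟨A,ΔA⟩ + V₀(A)`).  PLACEMENT: `Summits/QuantumFields/BalabanUV/`; imports this lineage's
`Support.NE3EnergyHessContTwoTerm` + `Support.NE3EnergySmallFieldCurl` and the Literature module `T4ConvexResponse`
(`taylor_lower`) BY NAME; restates nothing, moves nothing.  HONEST DEPENDENCY: continuum YM on T⁴ ⇐ BetaPertH ∧ nine spine
estimates (0/9 proved); BetaPertH ⇐ (D1) ∧ (D4) ∧ CAP+tail; G-an2-4 gates asym, D1 and NE2/3/4.
-/

set_option autoImplicit false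

open scoped BigOperators Matrix.Norms.L2Operator
open NormedSpace Finset

namespace Summit.QuantumFields.BalabanUV.T4Continuum.NE3LocalReadoutsTwoTerm

open Set
open Literature.MathematicalPhysics.QuantumFieldTheory.Balaban1983to89
open B7Prop1Explicit B7Prop2Explicit MatrixLog UnitaryModel
open T4AveragingDeficitWall hiding Site Plane Plaq Bond
open T4ConvexResponse (taylor_lower)
open AveragingDeficitPlaqDeriv (vary_isUnitaryCfg)
open NE3HessForm (dAction hess segment_derivData)
open NE3HessBounds (bondSq norm_curlAt_le)
open NE3EnergySource (abs_sum_nReTr_curl_fhol_le)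
open NE3EnergyHessTwoTerm (abs_hess_le_twoTerm)
open NE3EnergyHessContTwoTerm (sqrt_sum_curl_sq_vary_le)
open NE3EnergySmallFieldCurl (norm_fhol_vary_sub_one_le_curl)

noncomputable section

variable {d : ℕ} {n : Type*} [Fintype n] [DecidableEq n] [Nonempty n]

/-! ## §1 The Hessian along the unit segment, two-term form -/

/-- **THE HESSIAN ALONG THE SEGMENT `V e^{tX}`, TWO-TERM FORM.**  For unitary `V` with plaquette radius `a ≥ 0` on the
window `W`, skew `X` with `‖X(b)‖ ≤ α` (`α ≥ 0`) and window curl bound `‖(d_V X)(p)‖ ≤ γ` (`γ ≥ 0`), and `t ∈ [0,1]`: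
`|hess (V e^{tX}) X X W| ≤ (√C + 12(e^α−1)√B)² + 12·(a + γ + 24α(e^α−1))·B`,
`C = Σ_{p∈W}‖(d_V X)(p)‖²`, `B = Σ_{p∈W} bondSq X p`.  The window curl of the MOVING configuration is transported back to
`V` (`sqrt_sum_curl_sq_vary_le`), its plaquette radius is `≤ a + γ + 24α(e^α−1)` (`norm_fhol_vary_sub_one_le_curl`), and
the two-term bound `abs_hess_le_twoTerm` is applied at `V e^{tX}`. [folklore] -/
theorem abs_hess_vary_self_le_twoTerm {V : Site d → Fin d → (Matrix n n ℂ)ˣ} (hV : IsUnitaryCfg V)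
    {X : Site d → Fin d → Matrix n n ℂ} (hX : IsSkewDir X) {α : ℝ} (hα : 0 ≤ α) (hXα : ∀ x κ, ‖X x κ‖ ≤ α)
    (W : Finset (T4AveragingDeficitWall.Plaq d)) {a γ : ℝ} (ha0 : 0 ≤ a) (hγ0 : 0 ≤ γ)
    (ha : ∀ p ∈ W, ‖((fhol V p : (Matrix n n ℂ)ˣ) : Matrix n n ℂ) - 1‖ ≤ a)
    (hγ : ∀ p ∈ W, ‖curl V X p‖ ≤ γ) {t : ℝ} (ht : t ∈ Icc (0:ℝ) 1) :
    |hess (vary V X t) X X W|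
      ≤ (Real.sqrt (∑ p ∈ W, ‖curl V X p‖ ^ 2) + 12 * (Real.exp α - 1) * Real.sqrt (∑ p ∈ W, bondSq X p)) ^ 2
        + 12 * (a + γ + 24 * α * (Real.exp α - 1)) * ∑ p ∈ W, bondSq X p := by
  obtain ⟨ht0, ht1⟩ := ht
  -- the exponential factors along the segment are dominated by the one at `t = 1`
  have hδ0 : 0 ≤ Real.exp α - 1 := by linarith [Real.add_one_le_exp α]
  have htα : t * α ≤ α := by nlinarith
  have hexp_t : Real.exp (t * α) - 1 ≤ Real.exp α - 1 := by
    linarith [Real.exp_le_exp.mpr htα]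
  have hexp_abs : Real.exp (|t| * α) - 1 ≤ Real.exp α - 1 := by
    rw [abs_of_nonneg ht0]; exact hexp_t
  have hexp_t0 : 0 ≤ Real.exp (t * α) - 1 := by
    have : 0 ≤ t * α := mul_nonneg ht0 hα
    linarith [Real.add_one_le_exp (t * α)]
  -- the plaquette radius of the moving configuration on the window
  have hat := norm_fhol_vary_sub_one_le_curl hV hX hXα W hγ ha ht0
  have ha' : ∀ p ∈ W, ‖((fhol (vary V X t) p : (Matrix n n ℂ)ˣ) : Matrix n n ℂ) - 1‖
      ≤ a + γ + 24 * α * (Real.exp α - 1) := by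
    intro p hp
    have h1 := hat p hp
    have h2 : t * (γ + 24 * α * (Real.exp (t * α) - 1)) ≤ γ + 24 * α * (Real.exp α - 1) := by
      have hb0 : 0 ≤ γ + 24 * α * (Real.exp (t * α) - 1) := by positivity
      have hb1 : γ + 24 * α * (Real.exp (t * α) - 1) ≤ γ + 24 * α * (Real.exp α - 1) := by
        have := mul_le_mul_of_nonneg_left hexp_t (by positivity : (0:ℝ) ≤ 24 * α)
        linarith
      calc t * (γ + 24 * α * (Real.exp (t * α) - 1)) ≤ 1 * (γ + 24 * α * (Real.exp (t * α) - 1)) :=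
            mul_le_mul_of_nonneg_right ht1 hb0
        _ ≤ γ + 24 * α * (Real.exp α - 1) := by rw [one_mul]; exact hb1
    linarith
  have ha0' : 0 ≤ a + γ + 24 * α * (Real.exp α - 1) := by positivity
  -- the two-term bound at the moving configuration
  have h2t := abs_hess_le_twoTerm (vary_isUnitaryCfg hV hX t) X X W ha0' ha'
  -- curl transport
  have hcurl := sqrt_sum_curl_sq_vary_le hV hX hα hXα t X W
  set Ct := Real.sqrt (∑ p ∈ W, ‖curl (vary V X t) X p‖ ^ 2) with hCt
  set R := Real.sqrt (∑ p ∈ W, ‖curl V X p‖ ^ 2) + 12 * (Real.exp α - 1) * Real.sqrt (∑ p ∈ W, bondSq X p) with hR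
  have hB0 : 0 ≤ ∑ p ∈ W, bondSq X p := Finset.sum_nonneg fun p _ => by unfold NE3HessBounds.bondSq NE3HessBounds.bondSqAt; positivity
  have hsB := Real.sqrt_nonneg (∑ p ∈ W, bondSq X p)
  have hCt0 : 0 ≤ Ct := Real.sqrt_nonneg _
  have hCtR : Ct ≤ R := by
    have h12 : 12 * (Real.exp (|t| * α) - 1) * Real.sqrt (∑ p ∈ W, bondSq X p)
        ≤ 12 * (Real.exp α - 1) * Real.sqrt (∑ p ∈ W, bondSq X p) :=
      mul_le_mul_of_nonneg_right (mul_le_mul_of_nonneg_left hexp_abs (by norm_num)) hsB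
    rw [hR]; exact hcurl.trans (by linarith)
  have hCC : Ct * Ct ≤ R ^ 2 := by
    rw [sq]; exact mul_le_mul hCtR hCtR hCt0 (hCt0.trans hCtR)
  have hBB : Real.sqrt (∑ p ∈ W, bondSq X p) * Real.sqrt (∑ p ∈ W, bondSq X p) = ∑ p ∈ W, bondSq X p :=
    Real.mul_self_sqrt hB0
  rw [hBB] at h2t
  have h12a : 12 * (a + γ + 24 * α * (Real.exp α - 1)) * (Ct * Ct)
      ≤ 12 * (a + γ + 24 * α * (Real.exp α - 1)) * R ^ 2 :=
    mul_le_mul_of_nonneg_left hCC (by positivity)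
  calc |hess (vary V X t) X X W|
      ≤ Ct * Ct + 12 * (a + γ + 24 * α * (Real.exp α - 1)) * ∑ p ∈ W, bondSq X p := h2t
    _ ≤ R ^ 2 + 12 * (a + γ + 24 * α * (Real.exp α - 1)) * ∑ p ∈ W, bondSq X p := by linarith

/-! ## §2 Second-order Taylor along the unit segment -/

/-- **THE ACTION ALONG THE UNIT SEGMENT, TO SECOND ORDER, TWO-TERM FORM**: under the hypotheses of §1,
`|A_W(V e^X) − A_W(V) − dAction V X W| ≤ ½·[(√C + 12(e^α−1)√B)² + 12(a + γ + 24α(e^α−1))·B]`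
(`taylor_lower` for the action and for its negative over `segment_derivData`, with §1 as the uniform Hessian bound on
`[0,1]`).  REFINES `NE3LocalReadouts.abs_fineAction_vary_sub_sub_dAction_le` (`(7∕2)·Σ bondSq`): the `bondSq` part now
carries the plaquette radius and the sup of the direction. [folklore] -/
theorem abs_fineAction_vary_sub_sub_dAction_le_twoTerm {V : Site d → Fin d → (Matrix n n ℂ)ˣ} (hV : IsUnitaryCfg V)
    {X : Site d → Fin d → Matrix n n ℂ} (hX : IsSkewDir X) {α : ℝ} (hα : 0 ≤ α) (hXα : ∀ x κ, ‖X x κ‖ ≤ α)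
    (W : Finset (T4AveragingDeficitWall.Plaq d)) {a γ : ℝ} (ha0 : 0 ≤ a) (hγ0 : 0 ≤ γ)
    (ha : ∀ p ∈ W, ‖((fhol V p : (Matrix n n ℂ)ˣ) : Matrix n n ℂ) - 1‖ ≤ a)
    (hγ : ∀ p ∈ W, ‖curl V X p‖ ≤ γ) :
    |fineAction (vary V X 1) W - fineAction V W - dAction V X W|
      ≤ ((Real.sqrt (∑ p ∈ W, ‖curl V X p‖ ^ 2) + 12 * (Real.exp α - 1) * Real.sqrt (∑ p ∈ W, bondSq X p)) ^ 2
          + 12 * (a + γ + 24 * α * (Real.exp α - 1)) * ∑ p ∈ W, bondSq X p) / 2 := by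
  obtain ⟨h1, h2⟩ := segment_derivData V X W
  set M : ℝ := (Real.sqrt (∑ p ∈ W, ‖curl V X p‖ ^ 2)
      + 12 * (Real.exp α - 1) * Real.sqrt (∑ p ∈ W, bondSq X p)) ^ 2
    + 12 * (a + γ + 24 * α * (Real.exp α - 1)) * ∑ p ∈ W, bondSq X p with hM
  have hbound : ∀ t ∈ Icc (0 : ℝ) 1, |hess (vary V X t) X X W| ≤ M :=
    fun t ht => abs_hess_vary_self_le_twoTerm hV hX hα hXα W ha0 hγ0 ha hγ ht
  have hlo : ∀ t ∈ Icc (0 : ℝ) 1, -M ≤ hess (vary V X t) X X W := fun t ht =>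
    neg_le_of_abs_le (hbound t ht)
  have hup : ∀ t ∈ Icc (0 : ℝ) 1, -M ≤ -hess (vary V X t) X X W := fun t ht => by
    have := hbound t ht
    have := le_abs_self (hess (vary V X t) X X W)
    linarith
  -- lower Taylor bound for the action
  have lo := taylor_lower h1 h2 hlo
  -- lower Taylor bound for MINUS the action
  have h1' : ∀ t ∈ Icc (0 : ℝ) 1,
      HasDerivAt (fun s : ℝ => -fineAction (vary V X s) W) (-dAction (vary V X t) X W) t := fun t ht => (h1 t ht).neg
  have h2' : ∀ t ∈ Icc (0 : ℝ) 1,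
      HasDerivAt (fun s : ℝ => -dAction (vary V X s) X W) (-hess (vary V X t) X X W) t := fun t ht => (h2 t ht).neg
  have up := taylor_lower h1' h2' hup
  rw [vary_zero] at lo up
  rw [abs_le]
  constructor <;> linarith

/-! ## §3 The read-out: first variation plus the two-term second order -/

/-- **THE LOCAL ACTION READ-OUT, TWO-TERM FORM**: under the hypotheses of §1,
`|A_W(V e^X) − A_W(V)| ≤ a·Σ_{p∈W}‖(d_V X)(p)‖ + ½·[(√C + 12(e^α−1)√B)² + 12(a + γ + 24α(e^α−1))·B]`
(the linear term is the first variation against the plaquette radius, `NE3EnergySource.abs_sum_nReTr_curl_fhol_le`).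
[folklore] -/
theorem abs_fineAction_vary_sub_le_twoTerm {V : Site d → Fin d → (Matrix n n ℂ)ˣ} (hV : IsUnitaryCfg V)
    {X : Site d → Fin d → Matrix n n ℂ} (hX : IsSkewDir X) {α : ℝ} (hα : 0 ≤ α) (hXα : ∀ x κ, ‖X x κ‖ ≤ α)
    (W : Finset (T4AveragingDeficitWall.Plaq d)) {a γ : ℝ} (ha0 : 0 ≤ a) (hγ0 : 0 ≤ γ)
    (ha : ∀ p ∈ W, ‖((fhol V p : (Matrix n n ℂ)ˣ) : Matrix n n ℂ) - 1‖ ≤ a)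
    (hγ : ∀ p ∈ W, ‖curl V X p‖ ≤ γ) :
    |fineAction (vary V X 1) W - fineAction V W|
      ≤ a * ∑ p ∈ W, ‖curl V X p‖
        + ((Real.sqrt (∑ p ∈ W, ‖curl V X p‖ ^ 2) + 12 * (Real.exp α - 1) * Real.sqrt (∑ p ∈ W, bondSq X p)) ^ 2
            + 12 * (a + γ + 24 * α * (Real.exp α - 1)) * ∑ p ∈ W, bondSq X p) / 2 := by
  have h2 := abs_fineAction_vary_sub_sub_dAction_le_twoTerm hV hX hα hXα W ha0 hγ0 ha hγ
  have h1 : |dAction V X W| ≤ a * ∑ p ∈ W, ‖curl V X p‖ := by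
    unfold NE3HessForm.dAction
    rw [abs_neg]
    exact abs_sum_nReTr_curl_fhol_le hV hX W ha
  have e : fineAction (vary V X 1) W - fineAction V W
      = (fineAction (vary V X 1) W - fineAction V W - dAction V X W) + dAction V X W := by ring
  rw [e]
  exact (abs_add_le _ _).trans (by linarith)

/-- **THE (READOUT♯) TYPE, POLYNOMIAL DISPLAY**: under the hypotheses of §1, with `δ := e^α − 1`,
`|A_W(V e^X) − A_W(V)| ≤ a·Σ_W‖(d_V X)(p)‖ + Σ_W‖(d_V X)(p)‖² + (6a + 6γ + 144δ(α + δ))·Σ_W bondSq X p`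
— F-ne3p1-g19-1 §3's «`a·Σ‖curl‖ + C₁·Σ‖curl‖² + C₂·(a + ‖X‖_∞)·Σ bondSq`» with `C₁ = 1` and the `bondSq` coefficient
displayed (`γ ≤ O(α)` is the window curl-sup, `δ(α + δ) = O(α²)`); from §3 by `(x + y)² ≤ 2x² + 2y²`. [folklore] -/
theorem abs_fineAction_vary_sub_le_readout {V : Site d → Fin d → (Matrix n n ℂ)ˣ} (hV : IsUnitaryCfg V)
    {X : Site d → Fin d → Matrix n n ℂ} (hX : IsSkewDir X) {α : ℝ} (hα : 0 ≤ α) (hXα : ∀ x κ, ‖X x κ‖ ≤ α)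
    (W : Finset (T4AveragingDeficitWall.Plaq d)) {a γ : ℝ} (ha0 : 0 ≤ a) (hγ0 : 0 ≤ γ)
    (ha : ∀ p ∈ W, ‖((fhol V p : (Matrix n n ℂ)ˣ) : Matrix n n ℂ) - 1‖ ≤ a)
    (hγ : ∀ p ∈ W, ‖curl V X p‖ ≤ γ) :
    |fineAction (vary V X 1) W - fineAction V W|
      ≤ a * ∑ p ∈ W, ‖curl V X p‖ + ∑ p ∈ W, ‖curl V X p‖ ^ 2
        + (6 * a + 6 * γ + 144 * (Real.exp α - 1) * (α + (Real.exp α - 1))) * ∑ p ∈ W, bondSq X p := by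
  have h := abs_fineAction_vary_sub_le_twoTerm hV hX hα hXα W ha0 hγ0 ha hγ
  set C := ∑ p ∈ W, ‖curl V X p‖ ^ 2 with hC
  set B := ∑ p ∈ W, bondSq X p with hB
  set δ := Real.exp α - 1 with hδ
  have hC0 : 0 ≤ C := Finset.sum_nonneg fun p _ => sq_nonneg _
  have hB0 : 0 ≤ B := Finset.sum_nonneg fun p _ => by unfold NE3HessBounds.bondSq NE3HessBounds.bondSqAt; positivity
  have hsC : Real.sqrt C ^ 2 = C := Real.sq_sqrt hC0
  have hsB : Real.sqrt B ^ 2 = B := Real.sq_sqrt hB0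
  -- `(√C + 12δ√B)² ≤ 2C + 288 δ² B`
  have hsq : (Real.sqrt C + 12 * δ * Real.sqrt B) ^ 2 ≤ 2 * C + 288 * δ ^ 2 * B := by
    have h0 : 0 ≤ (Real.sqrt C - 12 * δ * Real.sqrt B) ^ 2 := sq_nonneg _
    nlinarith [hsC, hsB, h0]
  have hrest : ((Real.sqrt C + 12 * δ * Real.sqrt B) ^ 2 + 12 * (a + γ + 24 * α * δ) * B) / 2
      ≤ C + (6 * a + 6 * γ + 144 * δ * (α + δ)) * B := by
    have : ((Real.sqrt C + 12 * δ * Real.sqrt B) ^ 2 + 12 * (a + γ + 24 * α * δ) * B) / 2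
        ≤ (2 * C + 288 * δ ^ 2 * B + 12 * (a + γ + 24 * α * δ) * B) / 2 := by linarith
    refine this.trans (le_of_eq ?_)
    ring
  linarith

/-! ## §4 The socket shape of skeleton v1.9 §4b (E-READOUT♯): `γ` eliminated, second order isolated -/

omit [Nonempty n] in
/-- For unitary `V` and `‖X(b)‖ ≤ α` the window curl is at most `4α`: `‖(d_V X)(p)‖ ≤ 4α` (`NE3HessBounds.norm_curlAt_le`).
[folklore] -/
theorem norm_curl_le_four_mul {V : Site d → Fin d → (Matrix n n ℂ)ˣ} (hV : IsUnitaryCfg V)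
    {X : Site d → Fin d → Matrix n n ℂ} {α : ℝ} (hXα : ∀ x κ, ‖X x κ‖ ≤ α) (p : T4AveragingDeficitWall.Plaq d) :
    ‖curl V X p‖ ≤ 4 * α := by
  have h := norm_curlAt_le hV X p.1 p.2.1.1 p.2.1.2
  have h1 := hXα p.1 p.2.1.1
  have h2 := hXα (p.1 + e p.2.1.1) p.2.1.2
  have h3 := hXα (p.1 + e p.2.1.2) p.2.1.1
  have h4 := hXα p.1 p.2.1.2
  show ‖curlAt V X p.1 p.2.1.1 p.2.1.2‖ ≤ 4 * α
  linarith

/-- **THE (E-READOUT♯) SOCKET SHAPE, SECOND ORDER ISOLATED** (skeleton v1.9 §4b: «`|A_Y(V e^X) − A_Y(V) − dAction_Y(X)| ≤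
C₁·Σ_Y‖curl_V X‖² + C₂·(a + ‖X‖_∞ + ‖X‖_∞²)·Σ_Y bondSq X`»): for unitary `V` with plaquette radius `a ≥ 0` on `W`, skew `X`
with `‖X(b)‖ ≤ α` (`α ≥ 0`), `δ := e^α − 1`:
`|A_W(V e^X) − A_W(V) − dAction V X W| ≤ Σ_W‖(d_V X)(p)‖² + (6a + 24α + 144δ(α + δ))·Σ_W bondSq X p`
— `C₁ = 1`, and the `bondSq` coefficient is `6a + 24α + O(α²)` for bounded `α` (`δ ≤ α e^α`); the window curl-sup `γ` of §1–§3
is eliminated by `γ ≤ 4α`. [folklore] -/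
theorem abs_fineAction_vary_sub_sub_dAction_le_readout {V : Site d → Fin d → (Matrix n n ℂ)ˣ} (hV : IsUnitaryCfg V)
    {X : Site d → Fin d → Matrix n n ℂ} (hX : IsSkewDir X) {α : ℝ} (hα : 0 ≤ α) (hXα : ∀ x κ, ‖X x κ‖ ≤ α)
    (W : Finset (T4AveragingDeficitWall.Plaq d)) {a : ℝ} (ha0 : 0 ≤ a)
    (ha : ∀ p ∈ W, ‖((fhol V p : (Matrix n n ℂ)ˣ) : Matrix n n ℂ) - 1‖ ≤ a) :
    |fineAction (vary V X 1) W - fineAction V W - dAction V X W|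
      ≤ ∑ p ∈ W, ‖curl V X p‖ ^ 2
        + (6 * a + 24 * α + 144 * (Real.exp α - 1) * (α + (Real.exp α - 1))) * ∑ p ∈ W, bondSq X p := by
  have hγ0 : (0 : ℝ) ≤ 4 * α := by positivity
  have hγ : ∀ p ∈ W, ‖curl V X p‖ ≤ 4 * α := fun p _ => norm_curl_le_four_mul hV hXα p
  have h := abs_fineAction_vary_sub_sub_dAction_le_twoTerm hV hX hα hXα W ha0 hγ0 ha hγ
  set C := ∑ p ∈ W, ‖curl V X p‖ ^ 2 with hC
  set B := ∑ p ∈ W, bondSq X p with hB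
  set δ := Real.exp α - 1 with hδ
  have hC0 : 0 ≤ C := Finset.sum_nonneg fun p _ => sq_nonneg _
  have hB0 : 0 ≤ B := Finset.sum_nonneg fun p _ => by unfold NE3HessBounds.bondSq NE3HessBounds.bondSqAt; positivity
  have hsC : Real.sqrt C ^ 2 = C := Real.sq_sqrt hC0
  have hsB : Real.sqrt B ^ 2 = B := Real.sq_sqrt hB0
  have hsq : (Real.sqrt C + 12 * δ * Real.sqrt B) ^ 2 ≤ 2 * C + 288 * δ ^ 2 * B := by
    have h0 : 0 ≤ (Real.sqrt C - 12 * δ * Real.sqrt B) ^ 2 := sq_nonneg _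
    nlinarith [hsC, hsB, h0]
  have hrest : ((Real.sqrt C + 12 * δ * Real.sqrt B) ^ 2 + 12 * (a + 4 * α + 24 * α * δ) * B) / 2
      ≤ C + (6 * a + 24 * α + 144 * δ * (α + δ)) * B := by
    have : ((Real.sqrt C + 12 * δ * Real.sqrt B) ^ 2 + 12 * (a + 4 * α + 24 * α * δ) * B) / 2
        ≤ (2 * C + 288 * δ ^ 2 * B + 12 * (a + 4 * α + 24 * α * δ) * B) / 2 := by linarith
    refine this.trans (le_of_eq ?_)
    ring
  exact h.trans hrest

/-- The same with the first variation added back: `|A_W(V e^X) − A_W(V)| ≤ a·Σ_W‖d_V X‖ + Σ_W‖d_V X‖² + (6a + 24α + 144δ(α + δ))·Σ_W bondSq X`.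
[folklore] -/
theorem abs_fineAction_vary_sub_le_readout' {V : Site d → Fin d → (Matrix n n ℂ)ˣ} (hV : IsUnitaryCfg V)
    {X : Site d → Fin d → Matrix n n ℂ} (hX : IsSkewDir X) {α : ℝ} (hα : 0 ≤ α) (hXα : ∀ x κ, ‖X x κ‖ ≤ α)
    (W : Finset (T4AveragingDeficitWall.Plaq d)) {a : ℝ} (ha0 : 0 ≤ a)
    (ha : ∀ p ∈ W, ‖((fhol V p : (Matrix n n ℂ)ˣ) : Matrix n n ℂ) - 1‖ ≤ a) :
    |fineAction (vary V X 1) W - fineAction V W|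
      ≤ a * ∑ p ∈ W, ‖curl V X p‖ + ∑ p ∈ W, ‖curl V X p‖ ^ 2
        + (6 * a + 24 * α + 144 * (Real.exp α - 1) * (α + (Real.exp α - 1))) * ∑ p ∈ W, bondSq X p := by
  have h2 := abs_fineAction_vary_sub_sub_dAction_le_readout hV hX hα hXα W ha0 ha
  have h1 : |dAction V X W| ≤ a * ∑ p ∈ W, ‖curl V X p‖ := by
    unfold NE3HessForm.dAction
    rw [abs_neg]
    exact abs_sum_nReTr_curl_fhol_le hV hX W ha
  have e : fineAction (vary V X 1) W - fineAction V W
      = (fineAction (vary V X 1) W - fineAction V W - dAction V X W) + dAction V X W := by ring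
  rw [e]
  exact (abs_add_le _ _).trans (by linarith)

end

end Summit.QuantumFields.BalabanUV.T4Continuum.NE3LocalReadoutsTwoTerm
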